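import Summits.QuantumFields.YangMills.Theorems.BalabanUVNodesN21ShellSplitOfRecord13CoPHChartKeyed
import Summits.QuantumFields.YangMills.Theorems.BalabanUVNodesN21LowCentreEndAtSUNBlockChartJacobianEnd

/-!
# N21 (NE7c) · THE KNIT AT THE RECORD FROM PER-FIBRE [LF-II] §1 LETTERS ON THE EXPONENTIAL `SU(N)` BLOCK CHART (dag-lead WIDTH-209 N21 piece 4,
# literal form): dag-n21-d's END `shellWeightBound_crOfRecord₁₃At_shellSplit_of_blockFibreAC` with its one displayed estimate replaced, per
# (run, K, |t| ≤ 1, top cube, exterior field), by dag-n21-w1's DRESSED chart letters — window factorisation, dressed presentation `hR`, convex cuts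
# `K_c ∋ 0`, CONVEX (1.2) exponent `A` with the printed rows (1.9) `Ineq19` ∕ (1.6) `Ineq16` ∕ `|Vt| ≤ W_V`, the statistic's Lipschitz ∕ core ∕ envelope ∕
# radial-transversality binders, the odds `hQ`, ONE clause (Haar Jacobian's `W_J` inside) — through my socket p605800 (NO two-ratio dictionary)

Track A of `YM-PLAN.md` (cell `pub-ymgap`, HUMAN RULING D-0062 ∕ D-0149 width seats), node **N21**; WIDTH SEAT `pub-ymgap-dag-n21-w2` (gen 2), file 13.
THEOREMS ONLY: 0 `def`, 0 `sorry`; COUNT-NEUTRAL; `--kind proof --supports stmt-QuantumFields-20544 --as helper`.  Imports my socket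
`…N21ShellSplitOfRecord13CoPHChartKeyed` (p605800: ★★ `shellWeightBound_crOfRecord₁₃At_shellSplit_of_chartLaws` = dag-n21-d's ★★★★ from per-fibre ∃-packages of chart
data) and dag-n21-w1 g2's `…N21LowCentreEndAtSUNBlockChartJacobianEnd` (file 12: ★ `cutChartLawAC_of_sect1Letters_dressed`; with file 11's ★ `hdens_of_dressedPresentation`
— the two PRODUCERS of the package's last two conjuncts, token for token, as agreed on the bus l.28770).  NO Theses import.  Restates nothing; cites by name.

WHAT IS PROVED ([bookkeeping]; ONE `obtain` + ONE anonymous constructor per fibre).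
* ★★ `shellWeightBound_crOfRecord₁₃At_shellSplit_of_sect1LettersDressed` — `ShellWeightBound` at `crOfRecord₁₃At K₀ jcut (shellSplitOfRecord₁₃At N K₀ ρA ρB)` on the
  live-selector line FROM n20-d's extraction rows (`hsel`, (H-U), (H-ζ), `0 ≤ ζ`), the width letters' signs, constants `0 ≤ D_K` with `Σ_K D_K ρ_K < ∞` per run,
  `2 ≤ N`, and per (run, K, `|t| ≤ 1`, top cube `a`, exterior `x`) an ∃-PACKAGE OF DRESSED [LF-II]-§1 LETTERS on the exponential block chart of the input block
  (36 conjuncts, listed in the theorem; the LAST is the domination `3(#b·d_N+1)(1+Q)∕(κ₀(1−ρ_K)) ≤ D_K` of the END's per-fibre constant by the summable `D_K`).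
* `shellWeightBound_crOfRecord₁₃VAt_shellSplit_of_sect1LettersDressed` — the V edition (p605800 §3 road: `Iff.rfl` transfer p598391).

HONEST FRAMING.  EVERY letter in the packages is a HYPOTHESIS — located: the window factorisation of the dressed fibre density (small-field letters), the dressed
presentation `hR` (convexity of the (1.2) exponent on the chart — dag-n21-w3 g3's piece 2 — and the printed rows' identification with the N21 slot's block action:
NODE O's term object), the statistic's binders (radial transversality: dag-n21-w7's piece 1), the odds; inhabited for no family here (dag-n21-w1's A6 witnesses
p605099 §4 ∕ INTENT-12 inhabit the CHART-LEVEL binders at one toy bond, not the record's fibre); `hsel`, (H-ζ), `0 ≤ ζ`, widths, `D_K` HYPOTHESES; `jcut` displayed;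
K0⁷ OPEN; nothing of Bałaban's asserted; NE7c NOT PRINTED ∕ NOT proved; **N21 NOT discharged**; K3⁷ NOT claimed; counts UNMOVED (typed 28∕28 · discharged 5∕27);
one finite four-torus programme at fixed `ε` — NOT ℝ⁴, NOT infinite volume, NOT OS, NOT a mass gap, NOT Clay.  No decl below carries a cite tag.
-/

set_option autoImplicit false

open scoped BigOperators ENNReal
open Finset MeasureTheory Function Metric Set

namespace Summit.QuantumFields.YangMills.Theorems.N21ChartJunctionKeyed

open Literature.MathematicalPhysics.QuantumFieldTheory.Balaban1983to89
open Literature.MathematicalPhysics.QuantumFieldTheory.Balaban1983to89.T4Continuum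
open Literature.MathematicalPhysics.QuantumFieldTheory.Balaban1983to89.Node00 hiding dimSU
open T4ShellMeasure (SlotAntiConcentration)
open T4ShellMeasureDet (blockLaw)
open T4IndicatorShell (ShellWeightBound)
open B16Sect1Wilson (Ineq16 Ineq19)
open YMDAG.UVSplit (crOfRecord₁₃At crOfRecord₁₃VAt ShellSplit₁₃CoPH runA₁₃ runB₁₃ histA₁₃ histB₁₃)
open N21ShellSplitOfRecord13CoPH (WidthLetter₁₃CoPH shellSplitOfRecord₁₃At cubeStat inputBlock blockReading blockFibreLawOfDatum₉)
open N21DilationRoadAtRecord13CoPH (shellWeightBound_crOfRecord₁₃VAt_iff_crOfRecord₁₃At)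
open N21LowCentreEndAtSUNBlockChartJacobian (hdens_of_dressedPresentation)
open N21LowCentreEndAtSUNBlockChartJacobianEnd (cutChartLawAC_of_sect1Letters_dressed)
open Summit.QuantumFields.BalabanUV.T4Continuum.ShellMeasureExpChartSUN
  (SUN ChartSU BlockChartSU dimSU expFibreChartSU chartWeightSU)
open Summit.QuantumFields.BalabanUV.T4Continuum.ShellMeasureScalingSUN (windowSU)
open Summit.QuantumFields.BalabanUV.T4Continuum.ShellMeasureExpJacobianSUN (expJacWeightSU)
open Summit.QuantumFields.BalabanUV.T4Continuum.ShellMeasureExpHaarAreaSUN (kappaSU)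
open Summit.QuantumFields.BalabanUV.T4Continuum.ShellMeasureExpDuhamelSUN (duhT)

section AtRecord

variable {F : T4Family} {N : ℕ} [NeZero N]

/-- ★★ **dag-n21-d's END AT THE READING OF RECORD FROM PER-FIBRE DRESSED [LF-II]-§1 LETTERS ON THE EXPONENTIAL `SU(N)` BLOCK CHART** (`2 ≤ N`):
`ShellWeightBound` at `crOfRecord₁₃At K₀ jcut (shellSplitOfRecord₁₃At N K₀ ρA ρB)` from n20-d's extraction rows, the widths' signs, summable `D_K ρ_K`, and — per
(run, K, `|t| ≤ 1`, top cube `a`, exterior `x`) — an ∃-package over the chart data `(S, c, R, U, C, Env, K_c, A, Qf, lin, Vt, σ, κ₀, Q, L, γ₀, M, B₃, M₀, A₀, p₀g, Rk, W_V, d)` of: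
window `0 < S < π`, `Measurable R`, the WINDOW FACTORISATION of the block fibre law of record, the input block nonempty, measurabilities, `0 < ε_k`, `0 < ρ_K < 1`,
`ρ_K + σ ≤ 1`, signs of the constants, kept CONVEX cuts `K_c ∋ 0`, CONVEX exponent `A` with the (1.2) expansion and the PRINTED ROWS (1.9) `Ineq19` ∕ (1.6) `Ineq16` ∕
`|Vt| ≤ W_V`, the DRESSED PRESENTATION `hR` of the block weight on the window, the READING of the cube statistic of record by `U` on the window, `U` `L`-Lipschitz with
`U 0 ≤ σ ε_k`, ONE clause (Haar Jacobian's `W_J = #b·N²·(−2 log sinc S)` inside), the envelope and RADIAL TRANSVERSALITY of `U`, the odds `hQ` of the uncut windowed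
chart law, and the domination `3(#b·d_N+1)(1+Q)∕(κ₀(1−ρ_K)) ≤ D_K` — p605800 ★★ fed per fibre by dag-n21-w1's `hdens_of_dressedPresentation` +
`cutChartLawAC_of_sect1Letters_dressed` BY NAME. [bookkeeping] -/
theorem shellWeightBound_crOfRecord₁₃At_shellSplit_of_sect1LettersDressed (hN : 2 ≤ N) (K₀ : ℕ) (jcut : ℕ → ℕ) (ρA ρB : WidthLetter₁₃CoPH N)
    (θ : Stage13HParams F N) (hP : θ.Provisos₁₃CoPH F N) (g₀ : ℕ → ℝ) (os : List (ULoop F)) (E : B12.RunParams → ℝ)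
    (hsel : θ.ppSel = ppSelLiveOfRecord F N θ.ν θ.τ9 E (wOfRecord₉ F N θ.toStage9Params))
    (hU : LocalBgMeasurable F N θ.ν) (hζm : ZetaMeasurable F N θ.ζ) (hζ0 : ∀ p g k s Pl Ql RS U V', 0 ≤ θ.ζ p g k s Pl Ql RS U V')
    {DA DB : ℕ → ℝ} (hρA : ∀ K, 0 ≤ ρA F θ hP g₀ os K) (hDA : ∀ K, 0 ≤ DA K) (hρB : ∀ K, 0 ≤ ρB F θ hP g₀ os K) (hDB : ∀ K, 0 ≤ DB K)
    (hsA : Summable (fun K => DA K * ρA F θ hP g₀ os K)) (hsB : Summable (fun K => DB K * ρB F θ hP g₀ os K))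
    (hLA : ∀ (K : ℕ) (t : ℝ), |t| ≤ 1 →
      ∀ (a : ↥(cubeIndices (F.P (K₀ + K)) (cubeSide (F.P (K₀ + K)).L θ.ν.M₂ (RkOfRecord (F.P (K₀ + K)).L θ.ν.r (histA₁₃ θ K₀ g₀ K (K₀ + K))) (K₀ + K))))
        (x : GaugeField (F.P (K₀ + K)) (K₀ + K) (SU N)),
        ∃ (S : ℝ) (c : GaugeField (F.P (K₀ + K)) (K₀ + K) (SU N)) (R : (↥(inputBlock F θ.ν (histA₁₃ θ K₀ g₀ K) a) → SU N) → ℝ≥0∞)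
          (U : BlockChartSU N (inputBlock F θ.ν (histA₁₃ θ K₀ g₀ K) a) → ℝ) (C Env Kc : Set (BlockChartSU N (inputBlock F θ.ν (histA₁₃ θ K₀ g₀ K) a))) (A Qf lin Vt : BlockChartSU N (inputBlock F θ.ν (histA₁₃ θ K₀ g₀ K) a) → ℝ)
          (σ κ₀ Q L γ₀ M B₃ M₀ A₀ p₀g Rk WV : ℝ) (d : ℕ),
          0 < S ∧ S < Real.pi ∧ Measurable R ∧
          blockFibreLawOfDatum₉ F N θ.toStage9Params (datumOfRecord₁₃CoPH F N θ hP) g₀ os (runA₁₃ F K₀ g₀ K) (histA₁₃ θ K₀ g₀ K) (K₀ + K) t a (inputBlock F θ.ν (histA₁₃ θ K₀ g₀ K) a) x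
            = (blockLaw (inputBlock F θ.ν (histA₁₃ θ K₀ g₀ K) a)).withDensity (fun y => windowSU (inputBlock F θ.ν (histA₁₃ θ K₀ g₀ K) a) c S y * R y) ∧
          (inputBlock F θ.ν (histA₁₃ θ K₀ g₀ K) a).Nonempty ∧
          (Measurable fun z : BlockChartSU N (inputBlock F θ.ν (histA₁₃ θ K₀ g₀ K) a) => Kc.indicator (fun w => ENNReal.ofReal (Real.exp (-A w))) z) ∧
          Measurable U ∧ MeasurableSet C ∧ MeasurableSet Env ∧
          0 < epsOfRecord θ.ν (histA₁₃ θ K₀ g₀ K) (K₀ + K) ∧ 0 < ρA F θ hP g₀ os K ∧ ρA F θ hP g₀ os K < 1 ∧ ρA F θ hP g₀ os K + σ ≤ 1 ∧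
          0 < κ₀ ∧ 0 ≤ Q ∧ 0 < L ∧ 1 ≤ d ∧ 0 < M ∧ 0 < γ₀ ∧
          0 ≤ 3 * B₃ * M₀ * A₀ ^ 2 * p₀g ^ 2 * Real.exp (-Rk) * (100 * M) ^ 4 + WV ∧
          Convex ℝ Kc ∧ ConvexOn ℝ Kc A ∧ (0 : BlockChartSU N (inputBlock F θ.ν (histA₁₃ θ K₀ g₀ K) a)) ∈ Kc ∧
          (∀ v ∈ Kc, A v = A 0 + 1 / 2 * Qf v + lin v + Vt v) ∧
          (∀ v ∈ Kc, Ineq19 (Qf v) (∑ i, ‖v i‖ ^ 2) γ₀ d M) ∧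
          (∀ v ∈ Kc, Ineq16 (lin v) B₃ M₀ A₀ p₀g Rk M) ∧
          (∀ v ∈ Kc, |Vt v| ≤ WV) ∧
          (∀ z ∈ closedBall (0 : BlockChartSU N (inputBlock F θ.ν (histA₁₃ θ K₀ g₀ K) a)) S, R (expFibreChartSU (inputBlock F θ.ν (histA₁₃ θ K₀ g₀ K) a) c z) =
            ({z | U z < epsOfRecord θ.ν (histA₁₃ θ K₀ g₀ K) (K₀ + K)} ∩ C).indicator
              (fun z' => Kc.indicator (fun w => ENNReal.ofReal (Real.exp (-A w))) z') z) ∧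
          (∀ z ∈ closedBall (0 : BlockChartSU N (inputBlock F θ.ν (histA₁₃ θ K₀ g₀ K) a)) S,
            blockReading N (cubeStat F N θ.ν (histA₁₃ θ K₀ g₀ K) (Kc := K₀ + K) (k := K₀ + K) a) (inputBlock F θ.ν (histA₁₃ θ K₀ g₀ K) a) (fun _ => 1) (expFibreChartSU (inputBlock F θ.ν (histA₁₃ θ K₀ g₀ K) a) c z) = U z) ∧
          (∀ z z' : BlockChartSU N (inputBlock F θ.ν (histA₁₃ θ K₀ g₀ K) a), U z - U z' ≤ L * ‖z - z'‖) ∧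
          U 0 ≤ σ * epsOfRecord θ.ν (histA₁₃ θ K₀ g₀ K) (K₀ + K) ∧
          16 * (3 * B₃ * M₀ * A₀ ^ 2 * p₀g ^ 2 * Real.exp (-Rk) * (100 * M) ^ 4 +
              (WV + (inputBlock F θ.ν (histA₁₃ θ K₀ g₀ K) a).card * ((N * N : ℕ) * (-2 * Real.log (Real.sinc S))))) * d
            * (100 * M) ^ (d + 1) * (dimSU N * L ^ 2) ≤ γ₀ * (epsOfRecord θ.ν (histA₁₃ θ K₀ g₀ K) (K₀ + K) * (1 - ρA F θ hP g₀ os K - σ)) ^ 2 ∧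
          (∀ l ∈ Icc (1 - 1 / (((inputBlock F θ.ν (histA₁₃ θ K₀ g₀ K) a).card : ℝ) * dimSU N + 1)) 1, ∀ z : BlockChartSU N (inputBlock F θ.ν (histA₁₃ θ K₀ g₀ K) a),
            epsOfRecord θ.ν (histA₁₃ θ K₀ g₀ K) (K₀ + K) * (1 - ρA F θ hP g₀ os K) ≤ U z → U z < epsOfRecord θ.ν (histA₁₃ θ K₀ g₀ K) (K₀ + K) → z ∈ C → l • z ∈ Env) ∧
          (∀ z : BlockChartSU N (inputBlock F θ.ν (histA₁₃ θ K₀ g₀ K) a), epsOfRecord θ.ν (histA₁₃ θ K₀ g₀ K) (K₀ + K) * (1 - ρA F θ hP g₀ os K) ≤ U z → U z < epsOfRecord θ.ν (histA₁₃ θ K₀ g₀ K) (K₀ + K) → z ∈ C → ∀ s' : ℝ, 1 ≤ s' →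
            epsOfRecord θ.ν (histA₁₃ θ K₀ g₀ K) (K₀ + K) * (1 - ρA F θ hP g₀ os K) ≤ U (s' • z) → U (s' • z) < epsOfRecord θ.ν (histA₁₃ θ K₀ g₀ K) (K₀ + K) → s' • z ∈ C →
              U z + κ₀ * (epsOfRecord θ.ν (histA₁₃ θ K₀ g₀ K) (K₀ + K) * (1 - ρA F θ hP g₀ os K)) * (s' - 1) ≤ U (s' • z)) ∧
          ((volume : Measure (BlockChartSU N (inputBlock F θ.ν (histA₁₃ θ K₀ g₀ K) a))).withDensity (fun z =>
              chartWeightSU (inputBlock F θ.ν (histA₁₃ θ K₀ g₀ K) a) S (expJacWeightSU (kappaSU N)) z * Kc.indicator (fun w => ENNReal.ofReal (Real.exp (-A w))) z)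
              (Env \ ({z | U z < epsOfRecord θ.ν (histA₁₃ θ K₀ g₀ K) (K₀ + K)} ∩ C))
            ≤ ENNReal.ofReal Q * (volume : Measure (BlockChartSU N (inputBlock F θ.ν (histA₁₃ θ K₀ g₀ K) a))).withDensity (fun z =>
              chartWeightSU (inputBlock F θ.ν (histA₁₃ θ K₀ g₀ K) a) S (expJacWeightSU (kappaSU N)) z * Kc.indicator (fun w => ENNReal.ofReal (Real.exp (-A w))) z)
              ({z | U z < epsOfRecord θ.ν (histA₁₃ θ K₀ g₀ K) (K₀ + K)} ∩ C)) ∧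
          3 * (((inputBlock F θ.ν (histA₁₃ θ K₀ g₀ K) a).card : ℝ) * dimSU N + 1) * (1 + Q) / (κ₀ * (1 - ρA F θ hP g₀ os K)) ≤ DA K)
    (hLB : ∀ (K : ℕ) (t : ℝ), |t| ≤ 1 →
      ∀ (a : ↥(cubeIndices (F.P (K₀ + K + 1)) (cubeSide (F.P (K₀ + K + 1)).L θ.ν.M₂ (RkOfRecord (F.P (K₀ + K + 1)).L θ.ν.r (histB₁₃ θ K₀ g₀ K (K₀ + K + 1))) (K₀ + K + 1))))
        (x : GaugeField (F.P (K₀ + K + 1)) (K₀ + K + 1) (SU N)),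
        ∃ (S : ℝ) (c : GaugeField (F.P (K₀ + K + 1)) (K₀ + K + 1) (SU N)) (R : (↥(inputBlock F θ.ν (histB₁₃ θ K₀ g₀ K) a) → SU N) → ℝ≥0∞)
          (U : BlockChartSU N (inputBlock F θ.ν (histB₁₃ θ K₀ g₀ K) a) → ℝ) (C Env Kc : Set (BlockChartSU N (inputBlock F θ.ν (histB₁₃ θ K₀ g₀ K) a))) (A Qf lin Vt : BlockChartSU N (inputBlock F θ.ν (histB₁₃ θ K₀ g₀ K) a) → ℝ)
          (σ κ₀ Q L γ₀ M B₃ M₀ A₀ p₀g Rk WV : ℝ) (d : ℕ),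
          0 < S ∧ S < Real.pi ∧ Measurable R ∧
          blockFibreLawOfDatum₉ F N θ.toStage9Params (datumOfRecord₁₃CoPH F N θ hP) g₀ os (runB₁₃ F K₀ g₀ K) (histB₁₃ θ K₀ g₀ K) (K₀ + K + 1) t a (inputBlock F θ.ν (histB₁₃ θ K₀ g₀ K) a) x
            = (blockLaw (inputBlock F θ.ν (histB₁₃ θ K₀ g₀ K) a)).withDensity (fun y => windowSU (inputBlock F θ.ν (histB₁₃ θ K₀ g₀ K) a) c S y * R y) ∧
          (inputBlock F θ.ν (histB₁₃ θ K₀ g₀ K) a).Nonempty ∧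
          (Measurable fun z : BlockChartSU N (inputBlock F θ.ν (histB₁₃ θ K₀ g₀ K) a) => Kc.indicator (fun w => ENNReal.ofReal (Real.exp (-A w))) z) ∧
          Measurable U ∧ MeasurableSet C ∧ MeasurableSet Env ∧
          0 < epsOfRecord θ.ν (histB₁₃ θ K₀ g₀ K) (K₀ + K + 1) ∧ 0 < ρB F θ hP g₀ os K ∧ ρB F θ hP g₀ os K < 1 ∧ ρB F θ hP g₀ os K + σ ≤ 1 ∧
          0 < κ₀ ∧ 0 ≤ Q ∧ 0 < L ∧ 1 ≤ d ∧ 0 < M ∧ 0 < γ₀ ∧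
          0 ≤ 3 * B₃ * M₀ * A₀ ^ 2 * p₀g ^ 2 * Real.exp (-Rk) * (100 * M) ^ 4 + WV ∧
          Convex ℝ Kc ∧ ConvexOn ℝ Kc A ∧ (0 : BlockChartSU N (inputBlock F θ.ν (histB₁₃ θ K₀ g₀ K) a)) ∈ Kc ∧
          (∀ v ∈ Kc, A v = A 0 + 1 / 2 * Qf v + lin v + Vt v) ∧
          (∀ v ∈ Kc, Ineq19 (Qf v) (∑ i, ‖v i‖ ^ 2) γ₀ d M) ∧
          (∀ v ∈ Kc, Ineq16 (lin v) B₃ M₀ A₀ p₀g Rk M) ∧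
          (∀ v ∈ Kc, |Vt v| ≤ WV) ∧
          (∀ z ∈ closedBall (0 : BlockChartSU N (inputBlock F θ.ν (histB₁₃ θ K₀ g₀ K) a)) S, R (expFibreChartSU (inputBlock F θ.ν (histB₁₃ θ K₀ g₀ K) a) c z) =
            ({z | U z < epsOfRecord θ.ν (histB₁₃ θ K₀ g₀ K) (K₀ + K + 1)} ∩ C).indicator
              (fun z' => Kc.indicator (fun w => ENNReal.ofReal (Real.exp (-A w))) z') z) ∧
          (∀ z ∈ closedBall (0 : BlockChartSU N (inputBlock F θ.ν (histB₁₃ θ K₀ g₀ K) a)) S,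
            blockReading N (cubeStat F N θ.ν (histB₁₃ θ K₀ g₀ K) (Kc := K₀ + K + 1) (k := K₀ + K + 1) a) (inputBlock F θ.ν (histB₁₃ θ K₀ g₀ K) a) (fun _ => 1) (expFibreChartSU (inputBlock F θ.ν (histB₁₃ θ K₀ g₀ K) a) c z) = U z) ∧
          (∀ z z' : BlockChartSU N (inputBlock F θ.ν (histB₁₃ θ K₀ g₀ K) a), U z - U z' ≤ L * ‖z - z'‖) ∧
          U 0 ≤ σ * epsOfRecord θ.ν (histB₁₃ θ K₀ g₀ K) (K₀ + K + 1) ∧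
          16 * (3 * B₃ * M₀ * A₀ ^ 2 * p₀g ^ 2 * Real.exp (-Rk) * (100 * M) ^ 4 +
              (WV + (inputBlock F θ.ν (histB₁₃ θ K₀ g₀ K) a).card * ((N * N : ℕ) * (-2 * Real.log (Real.sinc S))))) * d
            * (100 * M) ^ (d + 1) * (dimSU N * L ^ 2) ≤ γ₀ * (epsOfRecord θ.ν (histB₁₃ θ K₀ g₀ K) (K₀ + K + 1) * (1 - ρB F θ hP g₀ os K - σ)) ^ 2 ∧
          (∀ l ∈ Icc (1 - 1 / (((inputBlock F θ.ν (histB₁₃ θ K₀ g₀ K) a).card : ℝ) * dimSU N + 1)) 1, ∀ z : BlockChartSU N (inputBlock F θ.ν (histB₁₃ θ K₀ g₀ K) a),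
            epsOfRecord θ.ν (histB₁₃ θ K₀ g₀ K) (K₀ + K + 1) * (1 - ρB F θ hP g₀ os K) ≤ U z → U z < epsOfRecord θ.ν (histB₁₃ θ K₀ g₀ K) (K₀ + K + 1) → z ∈ C → l • z ∈ Env) ∧
          (∀ z : BlockChartSU N (inputBlock F θ.ν (histB₁₃ θ K₀ g₀ K) a), epsOfRecord θ.ν (histB₁₃ θ K₀ g₀ K) (K₀ + K + 1) * (1 - ρB F θ hP g₀ os K) ≤ U z → U z < epsOfRecord θ.ν (histB₁₃ θ K₀ g₀ K) (K₀ + K + 1) → z ∈ C → ∀ s' : ℝ, 1 ≤ s' →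
            epsOfRecord θ.ν (histB₁₃ θ K₀ g₀ K) (K₀ + K + 1) * (1 - ρB F θ hP g₀ os K) ≤ U (s' • z) → U (s' • z) < epsOfRecord θ.ν (histB₁₃ θ K₀ g₀ K) (K₀ + K + 1) → s' • z ∈ C →
              U z + κ₀ * (epsOfRecord θ.ν (histB₁₃ θ K₀ g₀ K) (K₀ + K + 1) * (1 - ρB F θ hP g₀ os K)) * (s' - 1) ≤ U (s' • z)) ∧
          ((volume : Measure (BlockChartSU N (inputBlock F θ.ν (histB₁₃ θ K₀ g₀ K) a))).withDensity (fun z =>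
              chartWeightSU (inputBlock F θ.ν (histB₁₃ θ K₀ g₀ K) a) S (expJacWeightSU (kappaSU N)) z * Kc.indicator (fun w => ENNReal.ofReal (Real.exp (-A w))) z)
              (Env \ ({z | U z < epsOfRecord θ.ν (histB₁₃ θ K₀ g₀ K) (K₀ + K + 1)} ∩ C))
            ≤ ENNReal.ofReal Q * (volume : Measure (BlockChartSU N (inputBlock F θ.ν (histB₁₃ θ K₀ g₀ K) a))).withDensity (fun z =>
              chartWeightSU (inputBlock F θ.ν (histB₁₃ θ K₀ g₀ K) a) S (expJacWeightSU (kappaSU N)) z * Kc.indicator (fun w => ENNReal.ofReal (Real.exp (-A w))) z)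
              ({z | U z < epsOfRecord θ.ν (histB₁₃ θ K₀ g₀ K) (K₀ + K + 1)} ∩ C)) ∧
          3 * (((inputBlock F θ.ν (histB₁₃ θ K₀ g₀ K) a).card : ℝ) * dimSU N + 1) * (1 + Q) / (κ₀ * (1 - ρB F θ hP g₀ os K)) ≤ DB K)
    :
    ShellWeightBound (crOfRecord₁₃At K₀ jcut (shellSplitOfRecord₁₃At N K₀ ρA ρB) F θ hP g₀ os).l₀
      (crOfRecord₁₃At K₀ jcut (shellSplitOfRecord₁₃At N K₀ ρA ρB) F θ hP g₀ os).T (crOfRecord₁₃At K₀ jcut (shellSplitOfRecord₁₃At N K₀ ρA ρB) F θ hP g₀ os).A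
      (crOfRecord₁₃At K₀ jcut (shellSplitOfRecord₁₃At N K₀ ρA ρB) F θ hP g₀ os).B (crOfRecord₁₃At K₀ jcut (shellSplitOfRecord₁₃At N K₀ ρA ρB) F θ hP g₀ os).shA
      (crOfRecord₁₃At K₀ jcut (shellSplitOfRecord₁₃At N K₀ ρA ρB) F θ hP g₀ os).shB (crOfRecord₁₃At K₀ jcut (shellSplitOfRecord₁₃At N K₀ ρA ρB) F θ hP g₀ os).Wsh :=
  shellWeightBound_crOfRecord₁₃At_shellSplit_of_chartLaws K₀ jcut ρA ρB θ hP g₀ os E hsel hU hζm hζ0 hρA hDA hρB hDB hsA hsB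
    (fun K t ht a x => by
      obtain ⟨S, c, R, U, C, Env, Kc, A, Qf, lin, Vt, σ, κ₀, Q, L, γ₀, M, B₃, M₀, A₀, p₀g, Rk, WV, d,
        hS, hSπ, hRm, hlaw, hb, hAm, hUm, hC, hEnv, hθ, hρ0, hρ1, hρσ, hκ, hQ0, hL, hd, hM, hγ₀, hW, hK₀, hAconv, h0K₀,
        hexp, h19, h16, hV, hR, hread, hUL, hUc, hclause, henv, hRT, hQ, hD⟩ := hLA K t ht a x
      exact ⟨S, c, R, U, {z | U z < _} ∩ C, _, _, hS.le, hSπ.le, hRm, hlaw, (measurableSet_lt hUm measurable_const).inter hC, hread,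
        hdens_of_dressedPresentation _ hSπ.le c R U C Kc A _ hR,
        cutChartLawAC_of_sect1Letters_dressed hN _ hb hS hSπ Kc A Qf lin Vt hAm hUm hC hEnv hθ hρ0 hρ1 hρσ hκ hQ0 hL hd hM hγ₀ hW
          hK₀ hAconv h0K₀ hexp h19 h16 hV hUL hUc hclause henv hRT hQ, hD⟩)
    (fun K t ht a x => by
      obtain ⟨S, c, R, U, C, Env, Kc, A, Qf, lin, Vt, σ, κ₀, Q, L, γ₀, M, B₃, M₀, A₀, p₀g, Rk, WV, d,
        hS, hSπ, hRm, hlaw, hb, hAm, hUm, hC, hEnv, hθ, hρ0, hρ1, hρσ, hκ, hQ0, hL, hd, hM, hγ₀, hW, hK₀, hAconv, h0K₀,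
        hexp, h19, h16, hV, hR, hread, hUL, hUc, hclause, henv, hRT, hQ, hD⟩ := hLB K t ht a x
      exact ⟨S, c, R, U, {z | U z < _} ∩ C, _, _, hS.le, hSπ.le, hRm, hlaw, (measurableSet_lt hUm measurable_const).inter hC, hread,
        hdens_of_dressedPresentation _ hSπ.le c R U C Kc A _ hR,
        cutChartLawAC_of_sect1Letters_dressed hN _ hb hS hSπ Kc A Qf lin Vt hAm hUm hC hEnv hθ hρ0 hρ1 hρσ hκ hQ0 hL hd hM hγ₀ hW
          hK₀ hAconv h0K₀ hexp h19 h16 hV hUL hUc hclause henv hRT hQ, hD⟩)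

/-- The V edition at the physical-volume reading `crOfRecord₁₃VAt` (K3⁷'s pin; `Iff.rfl` transfer p598391). [bookkeeping] -/
theorem shellWeightBound_crOfRecord₁₃VAt_shellSplit_of_sect1LettersDressed (hN : 2 ≤ N) (K₀ : ℕ) (jcut : ℕ → ℕ) (ρA ρB : WidthLetter₁₃CoPH N)
    (θ : Stage13HParams F N) (hP : θ.Provisos₁₃CoPH F N) (g₀ : ℕ → ℝ) (os : List (ULoop F)) (E : B12.RunParams → ℝ)
    (hsel : θ.ppSel = ppSelLiveOfRecord F N θ.ν θ.τ9 E (wOfRecord₉ F N θ.toStage9Params))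
    (hU : LocalBgMeasurable F N θ.ν) (hζm : ZetaMeasurable F N θ.ζ) (hζ0 : ∀ p g k s Pl Ql RS U V', 0 ≤ θ.ζ p g k s Pl Ql RS U V')
    {DA DB : ℕ → ℝ} (hρA : ∀ K, 0 ≤ ρA F θ hP g₀ os K) (hDA : ∀ K, 0 ≤ DA K) (hρB : ∀ K, 0 ≤ ρB F θ hP g₀ os K) (hDB : ∀ K, 0 ≤ DB K)
    (hsA : Summable (fun K => DA K * ρA F θ hP g₀ os K)) (hsB : Summable (fun K => DB K * ρB F θ hP g₀ os K))
    (hLA : ∀ (K : ℕ) (t : ℝ), |t| ≤ 1 →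
      ∀ (a : ↥(cubeIndices (F.P (K₀ + K)) (cubeSide (F.P (K₀ + K)).L θ.ν.M₂ (RkOfRecord (F.P (K₀ + K)).L θ.ν.r (histA₁₃ θ K₀ g₀ K (K₀ + K))) (K₀ + K))))
        (x : GaugeField (F.P (K₀ + K)) (K₀ + K) (SU N)),
        ∃ (S : ℝ) (c : GaugeField (F.P (K₀ + K)) (K₀ + K) (SU N)) (R : (↥(inputBlock F θ.ν (histA₁₃ θ K₀ g₀ K) a) → SU N) → ℝ≥0∞)
          (U : BlockChartSU N (inputBlock F θ.ν (histA₁₃ θ K₀ g₀ K) a) → ℝ) (C Env Kc : Set (BlockChartSU N (inputBlock F θ.ν (histA₁₃ θ K₀ g₀ K) a))) (A Qf lin Vt : BlockChartSU N (inputBlock F θ.ν (histA₁₃ θ K₀ g₀ K) a) → ℝ)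
          (σ κ₀ Q L γ₀ M B₃ M₀ A₀ p₀g Rk WV : ℝ) (d : ℕ),
          0 < S ∧ S < Real.pi ∧ Measurable R ∧
          blockFibreLawOfDatum₉ F N θ.toStage9Params (datumOfRecord₁₃CoPH F N θ hP) g₀ os (runA₁₃ F K₀ g₀ K) (histA₁₃ θ K₀ g₀ K) (K₀ + K) t a (inputBlock F θ.ν (histA₁₃ θ K₀ g₀ K) a) x
            = (blockLaw (inputBlock F θ.ν (histA₁₃ θ K₀ g₀ K) a)).withDensity (fun y => windowSU (inputBlock F θ.ν (histA₁₃ θ K₀ g₀ K) a) c S y * R y) ∧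
          (inputBlock F θ.ν (histA₁₃ θ K₀ g₀ K) a).Nonempty ∧
          (Measurable fun z : BlockChartSU N (inputBlock F θ.ν (histA₁₃ θ K₀ g₀ K) a) => Kc.indicator (fun w => ENNReal.ofReal (Real.exp (-A w))) z) ∧
          Measurable U ∧ MeasurableSet C ∧ MeasurableSet Env ∧
          0 < epsOfRecord θ.ν (histA₁₃ θ K₀ g₀ K) (K₀ + K) ∧ 0 < ρA F θ hP g₀ os K ∧ ρA F θ hP g₀ os K < 1 ∧ ρA F θ hP g₀ os K + σ ≤ 1 ∧
          0 < κ₀ ∧ 0 ≤ Q ∧ 0 < L ∧ 1 ≤ d ∧ 0 < M ∧ 0 < γ₀ ∧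
          0 ≤ 3 * B₃ * M₀ * A₀ ^ 2 * p₀g ^ 2 * Real.exp (-Rk) * (100 * M) ^ 4 + WV ∧
          Convex ℝ Kc ∧ ConvexOn ℝ Kc A ∧ (0 : BlockChartSU N (inputBlock F θ.ν (histA₁₃ θ K₀ g₀ K) a)) ∈ Kc ∧
          (∀ v ∈ Kc, A v = A 0 + 1 / 2 * Qf v + lin v + Vt v) ∧
          (∀ v ∈ Kc, Ineq19 (Qf v) (∑ i, ‖v i‖ ^ 2) γ₀ d M) ∧
          (∀ v ∈ Kc, Ineq16 (lin v) B₃ M₀ A₀ p₀g Rk M) ∧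
          (∀ v ∈ Kc, |Vt v| ≤ WV) ∧
          (∀ z ∈ closedBall (0 : BlockChartSU N (inputBlock F θ.ν (histA₁₃ θ K₀ g₀ K) a)) S, R (expFibreChartSU (inputBlock F θ.ν (histA₁₃ θ K₀ g₀ K) a) c z) =
            ({z | U z < epsOfRecord θ.ν (histA₁₃ θ K₀ g₀ K) (K₀ + K)} ∩ C).indicator
              (fun z' => Kc.indicator (fun w => ENNReal.ofReal (Real.exp (-A w))) z') z) ∧
          (∀ z ∈ closedBall (0 : BlockChartSU N (inputBlock F θ.ν (histA₁₃ θ K₀ g₀ K) a)) S,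
            blockReading N (cubeStat F N θ.ν (histA₁₃ θ K₀ g₀ K) (Kc := K₀ + K) (k := K₀ + K) a) (inputBlock F θ.ν (histA₁₃ θ K₀ g₀ K) a) (fun _ => 1) (expFibreChartSU (inputBlock F θ.ν (histA₁₃ θ K₀ g₀ K) a) c z) = U z) ∧
          (∀ z z' : BlockChartSU N (inputBlock F θ.ν (histA₁₃ θ K₀ g₀ K) a), U z - U z' ≤ L * ‖z - z'‖) ∧
          U 0 ≤ σ * epsOfRecord θ.ν (histA₁₃ θ K₀ g₀ K) (K₀ + K) ∧
          16 * (3 * B₃ * M₀ * A₀ ^ 2 * p₀g ^ 2 * Real.exp (-Rk) * (100 * M) ^ 4 +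
              (WV + (inputBlock F θ.ν (histA₁₃ θ K₀ g₀ K) a).card * ((N * N : ℕ) * (-2 * Real.log (Real.sinc S))))) * d
            * (100 * M) ^ (d + 1) * (dimSU N * L ^ 2) ≤ γ₀ * (epsOfRecord θ.ν (histA₁₃ θ K₀ g₀ K) (K₀ + K) * (1 - ρA F θ hP g₀ os K - σ)) ^ 2 ∧
          (∀ l ∈ Icc (1 - 1 / (((inputBlock F θ.ν (histA₁₃ θ K₀ g₀ K) a).card : ℝ) * dimSU N + 1)) 1, ∀ z : BlockChartSU N (inputBlock F θ.ν (histA₁₃ θ K₀ g₀ K) a),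
            epsOfRecord θ.ν (histA₁₃ θ K₀ g₀ K) (K₀ + K) * (1 - ρA F θ hP g₀ os K) ≤ U z → U z < epsOfRecord θ.ν (histA₁₃ θ K₀ g₀ K) (K₀ + K) → z ∈ C → l • z ∈ Env) ∧
          (∀ z : BlockChartSU N (inputBlock F θ.ν (histA₁₃ θ K₀ g₀ K) a), epsOfRecord θ.ν (histA₁₃ θ K₀ g₀ K) (K₀ + K) * (1 - ρA F θ hP g₀ os K) ≤ U z → U z < epsOfRecord θ.ν (histA₁₃ θ K₀ g₀ K) (K₀ + K) → z ∈ C → ∀ s' : ℝ, 1 ≤ s' →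
            epsOfRecord θ.ν (histA₁₃ θ K₀ g₀ K) (K₀ + K) * (1 - ρA F θ hP g₀ os K) ≤ U (s' • z) → U (s' • z) < epsOfRecord θ.ν (histA₁₃ θ K₀ g₀ K) (K₀ + K) → s' • z ∈ C →
              U z + κ₀ * (epsOfRecord θ.ν (histA₁₃ θ K₀ g₀ K) (K₀ + K) * (1 - ρA F θ hP g₀ os K)) * (s' - 1) ≤ U (s' • z)) ∧
          ((volume : Measure (BlockChartSU N (inputBlock F θ.ν (histA₁₃ θ K₀ g₀ K) a))).withDensity (fun z =>
              chartWeightSU (inputBlock F θ.ν (histA₁₃ θ K₀ g₀ K) a) S (expJacWeightSU (kappaSU N)) z * Kc.indicator (fun w => ENNReal.ofReal (Real.exp (-A w))) z)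
              (Env \ ({z | U z < epsOfRecord θ.ν (histA₁₃ θ K₀ g₀ K) (K₀ + K)} ∩ C))
            ≤ ENNReal.ofReal Q * (volume : Measure (BlockChartSU N (inputBlock F θ.ν (histA₁₃ θ K₀ g₀ K) a))).withDensity (fun z =>
              chartWeightSU (inputBlock F θ.ν (histA₁₃ θ K₀ g₀ K) a) S (expJacWeightSU (kappaSU N)) z * Kc.indicator (fun w => ENNReal.ofReal (Real.exp (-A w))) z)
              ({z | U z < epsOfRecord θ.ν (histA₁₃ θ K₀ g₀ K) (K₀ + K)} ∩ C)) ∧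
          3 * (((inputBlock F θ.ν (histA₁₃ θ K₀ g₀ K) a).card : ℝ) * dimSU N + 1) * (1 + Q) / (κ₀ * (1 - ρA F θ hP g₀ os K)) ≤ DA K)
    (hLB : ∀ (K : ℕ) (t : ℝ), |t| ≤ 1 →
      ∀ (a : ↥(cubeIndices (F.P (K₀ + K + 1)) (cubeSide (F.P (K₀ + K + 1)).L θ.ν.M₂ (RkOfRecord (F.P (K₀ + K + 1)).L θ.ν.r (histB₁₃ θ K₀ g₀ K (K₀ + K + 1))) (K₀ + K + 1))))
        (x : GaugeField (F.P (K₀ + K + 1)) (K₀ + K + 1) (SU N)),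
        ∃ (S : ℝ) (c : GaugeField (F.P (K₀ + K + 1)) (K₀ + K + 1) (SU N)) (R : (↥(inputBlock F θ.ν (histB₁₃ θ K₀ g₀ K) a) → SU N) → ℝ≥0∞)
          (U : BlockChartSU N (inputBlock F θ.ν (histB₁₃ θ K₀ g₀ K) a) → ℝ) (C Env Kc : Set (BlockChartSU N (inputBlock F θ.ν (histB₁₃ θ K₀ g₀ K) a))) (A Qf lin Vt : BlockChartSU N (inputBlock F θ.ν (histB₁₃ θ K₀ g₀ K) a) → ℝ)
          (σ κ₀ Q L γ₀ M B₃ M₀ A₀ p₀g Rk WV : ℝ) (d : ℕ),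
          0 < S ∧ S < Real.pi ∧ Measurable R ∧
          blockFibreLawOfDatum₉ F N θ.toStage9Params (datumOfRecord₁₃CoPH F N θ hP) g₀ os (runB₁₃ F K₀ g₀ K) (histB₁₃ θ K₀ g₀ K) (K₀ + K + 1) t a (inputBlock F θ.ν (histB₁₃ θ K₀ g₀ K) a) x
            = (blockLaw (inputBlock F θ.ν (histB₁₃ θ K₀ g₀ K) a)).withDensity (fun y => windowSU (inputBlock F θ.ν (histB₁₃ θ K₀ g₀ K) a) c S y * R y) ∧
          (inputBlock F θ.ν (histB₁₃ θ K₀ g₀ K) a).Nonempty ∧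
          (Measurable fun z : BlockChartSU N (inputBlock F θ.ν (histB₁₃ θ K₀ g₀ K) a) => Kc.indicator (fun w => ENNReal.ofReal (Real.exp (-A w))) z) ∧
          Measurable U ∧ MeasurableSet C ∧ MeasurableSet Env ∧
          0 < epsOfRecord θ.ν (histB₁₃ θ K₀ g₀ K) (K₀ + K + 1) ∧ 0 < ρB F θ hP g₀ os K ∧ ρB F θ hP g₀ os K < 1 ∧ ρB F θ hP g₀ os K + σ ≤ 1 ∧
          0 < κ₀ ∧ 0 ≤ Q ∧ 0 < L ∧ 1 ≤ d ∧ 0 < M ∧ 0 < γ₀ ∧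
          0 ≤ 3 * B₃ * M₀ * A₀ ^ 2 * p₀g ^ 2 * Real.exp (-Rk) * (100 * M) ^ 4 + WV ∧
          Convex ℝ Kc ∧ ConvexOn ℝ Kc A ∧ (0 : BlockChartSU N (inputBlock F θ.ν (histB₁₃ θ K₀ g₀ K) a)) ∈ Kc ∧
          (∀ v ∈ Kc, A v = A 0 + 1 / 2 * Qf v + lin v + Vt v) ∧
          (∀ v ∈ Kc, Ineq19 (Qf v) (∑ i, ‖v i‖ ^ 2) γ₀ d M) ∧
          (∀ v ∈ Kc, Ineq16 (lin v) B₃ M₀ A₀ p₀g Rk M) ∧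
          (∀ v ∈ Kc, |Vt v| ≤ WV) ∧
          (∀ z ∈ closedBall (0 : BlockChartSU N (inputBlock F θ.ν (histB₁₃ θ K₀ g₀ K) a)) S, R (expFibreChartSU (inputBlock F θ.ν (histB₁₃ θ K₀ g₀ K) a) c z) =
            ({z | U z < epsOfRecord θ.ν (histB₁₃ θ K₀ g₀ K) (K₀ + K + 1)} ∩ C).indicator
              (fun z' => Kc.indicator (fun w => ENNReal.ofReal (Real.exp (-A w))) z') z) ∧
          (∀ z ∈ closedBall (0 : BlockChartSU N (inputBlock F θ.ν (histB₁₃ θ K₀ g₀ K) a)) S,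
            blockReading N (cubeStat F N θ.ν (histB₁₃ θ K₀ g₀ K) (Kc := K₀ + K + 1) (k := K₀ + K + 1) a) (inputBlock F θ.ν (histB₁₃ θ K₀ g₀ K) a) (fun _ => 1) (expFibreChartSU (inputBlock F θ.ν (histB₁₃ θ K₀ g₀ K) a) c z) = U z) ∧
          (∀ z z' : BlockChartSU N (inputBlock F θ.ν (histB₁₃ θ K₀ g₀ K) a), U z - U z' ≤ L * ‖z - z'‖) ∧
          U 0 ≤ σ * epsOfRecord θ.ν (histB₁₃ θ K₀ g₀ K) (K₀ + K + 1) ∧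
          16 * (3 * B₃ * M₀ * A₀ ^ 2 * p₀g ^ 2 * Real.exp (-Rk) * (100 * M) ^ 4 +
              (WV + (inputBlock F θ.ν (histB₁₃ θ K₀ g₀ K) a).card * ((N * N : ℕ) * (-2 * Real.log (Real.sinc S))))) * d
            * (100 * M) ^ (d + 1) * (dimSU N * L ^ 2) ≤ γ₀ * (epsOfRecord θ.ν (histB₁₃ θ K₀ g₀ K) (K₀ + K + 1) * (1 - ρB F θ hP g₀ os K - σ)) ^ 2 ∧
          (∀ l ∈ Icc (1 - 1 / (((inputBlock F θ.ν (histB₁₃ θ K₀ g₀ K) a).card : ℝ) * dimSU N + 1)) 1, ∀ z : BlockChartSU N (inputBlock F θ.ν (histB₁₃ θ K₀ g₀ K) a),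
            epsOfRecord θ.ν (histB₁₃ θ K₀ g₀ K) (K₀ + K + 1) * (1 - ρB F θ hP g₀ os K) ≤ U z → U z < epsOfRecord θ.ν (histB₁₃ θ K₀ g₀ K) (K₀ + K + 1) → z ∈ C → l • z ∈ Env) ∧
          (∀ z : BlockChartSU N (inputBlock F θ.ν (histB₁₃ θ K₀ g₀ K) a), epsOfRecord θ.ν (histB₁₃ θ K₀ g₀ K) (K₀ + K + 1) * (1 - ρB F θ hP g₀ os K) ≤ U z → U z < epsOfRecord θ.ν (histB₁₃ θ K₀ g₀ K) (K₀ + K + 1) → z ∈ C → ∀ s' : ℝ, 1 ≤ s' →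
            epsOfRecord θ.ν (histB₁₃ θ K₀ g₀ K) (K₀ + K + 1) * (1 - ρB F θ hP g₀ os K) ≤ U (s' • z) → U (s' • z) < epsOfRecord θ.ν (histB₁₃ θ K₀ g₀ K) (K₀ + K + 1) → s' • z ∈ C →
              U z + κ₀ * (epsOfRecord θ.ν (histB₁₃ θ K₀ g₀ K) (K₀ + K + 1) * (1 - ρB F θ hP g₀ os K)) * (s' - 1) ≤ U (s' • z)) ∧
          ((volume : Measure (BlockChartSU N (inputBlock F θ.ν (histB₁₃ θ K₀ g₀ K) a))).withDensity (fun z =>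
              chartWeightSU (inputBlock F θ.ν (histB₁₃ θ K₀ g₀ K) a) S (expJacWeightSU (kappaSU N)) z * Kc.indicator (fun w => ENNReal.ofReal (Real.exp (-A w))) z)
              (Env \ ({z | U z < epsOfRecord θ.ν (histB₁₃ θ K₀ g₀ K) (K₀ + K + 1)} ∩ C))
            ≤ ENNReal.ofReal Q * (volume : Measure (BlockChartSU N (inputBlock F θ.ν (histB₁₃ θ K₀ g₀ K) a))).withDensity (fun z =>
              chartWeightSU (inputBlock F θ.ν (histB₁₃ θ K₀ g₀ K) a) S (expJacWeightSU (kappaSU N)) z * Kc.indicator (fun w => ENNReal.ofReal (Real.exp (-A w))) z)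
              ({z | U z < epsOfRecord θ.ν (histB₁₃ θ K₀ g₀ K) (K₀ + K + 1)} ∩ C)) ∧
          3 * (((inputBlock F θ.ν (histB₁₃ θ K₀ g₀ K) a).card : ℝ) * dimSU N + 1) * (1 + Q) / (κ₀ * (1 - ρB F θ hP g₀ os K)) ≤ DB K)
    :
    ShellWeightBound (crOfRecord₁₃VAt K₀ jcut (shellSplitOfRecord₁₃At N K₀ ρA ρB) F θ hP g₀ os).l₀
      (crOfRecord₁₃VAt K₀ jcut (shellSplitOfRecord₁₃At N K₀ ρA ρB) F θ hP g₀ os).T (crOfRecord₁₃VAt K₀ jcut (shellSplitOfRecord₁₃At N K₀ ρA ρB) F θ hP g₀ os).A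
      (crOfRecord₁₃VAt K₀ jcut (shellSplitOfRecord₁₃At N K₀ ρA ρB) F θ hP g₀ os).B (crOfRecord₁₃VAt K₀ jcut (shellSplitOfRecord₁₃At N K₀ ρA ρB) F θ hP g₀ os).shA
      (crOfRecord₁₃VAt K₀ jcut (shellSplitOfRecord₁₃At N K₀ ρA ρB) F θ hP g₀ os).shB (crOfRecord₁₃VAt K₀ jcut (shellSplitOfRecord₁₃At N K₀ ρA ρB) F θ hP g₀ os).Wsh :=
  (shellWeightBound_crOfRecord₁₃VAt_iff_crOfRecord₁₃At K₀ jcut (shellSplitOfRecord₁₃At N K₀ ρA ρB) θ hP g₀ os).mpr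
    (shellWeightBound_crOfRecord₁₃At_shellSplit_of_sect1LettersDressed hN K₀ jcut ρA ρB θ hP g₀ os E hsel hU hζm hζ0 hρA hDA hρB hDB hsA hsB hLA hLB)

end AtRecord

end Summit.QuantumFields.YangMills.Theorems.N21ChartJunctionKeyed
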